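import Summits.Schanuel.Schanuel.Theses.PolarPhantoms
import Literature.Barriers.Schanuel.LargeTranscendenceDegreeSmallTrdegProofs
import Literature.Barriers.Schanuel.AlgebraicIndependenceOfLogarithms

/-!
# Refutation of `PolarPhantoms.PhantomsAreTraceless` (stmt-Schanuel-6846)

**Specialization phantoms.** Take `n = 2`, `y = (1, ξ)`, `α = (ξ, 1)` with `ξ ∈ ℂ` transcendental
(here `ξ = e`, Hermite; any transcendental works): `y` is `ℚ`-free, `α ∈ (ℂˣ)²`, and
`trdeg_ℚ ℚ(y, α) = trdeg_ℚ ℚ(ξ) = 1 < 2`, so the point is in the scope of the crux. Roy's multi-orbit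
is `(m·y, α^m) = (m₀ + m₁ ξ, ξ^{m₀})`, all box values `(D^k X₀^a X₁^b)(m·y, α^m)` lie in `ℚ[ξ]`, and the
`ℚ`-linear functional `λ₀ = ` "constant term in `ξ`" (extended to `ℂ`) is a RING HOMOMORPHISM on `ℚ[ξ]`:
`λ₀((D^k P)(m₀ + m₁ξ, ξ^{m₀})) = (D^k P)(m₀, 0^{m₀})`. Under `ξ ↦ 0` the multi-orbit collapses onto
`{(0, 1)} ∪ {(m₀, 0) : m₀ ≥ 1}`; since `X₁^b ∣ D^k(X₀^a X₁^b)`, every value with `m₀ ≥ 1`, `b ≥ 1`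
specializes to `0`, and at `(0,1)` only the `K + 1 = ⌊N^{s₀}⌋ + 1` derivatives remain. The family
`θ_{ab} = z_{ab} · λ₀` (`z ∈ ℚ`, supported on `b ≥ 1`) is therefore a phantom as soon as
`Σ_{a, b ≥ 1} z_{ab} (D^k X₀^a X₁^b)(0, 1) = 0` for `k ≤ K`: `K + 1` homogeneous equations in
`(⌊N^{t₀}⌋ + 1)·⌊N^{t₁}⌋` unknowns. Roy's window forces `1 < s₀ < u < (1 + t₀ + t₁)/2`, hence
`s₀ < t₀ + t₁`, so for EVERY admissible parameter set and all large `N` a non-zero `z` exists, and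
`θ_{ab}(1) = z_{ab} ≠ 0` for some `(a, b)` in the box: a phantom WITH a trace.
Refuter seat refuter-cdisprove-stmt-Schanuel-6846-0, 2026-08-15 (numerics: folder
`compute_jobs/phantom.py`, box `(D₀,D₁,K,M) = (4,2,8,3)`: all ten directions `b ≥ 1` traced at
`y = (1,T), α = (T,1)` and at `α = (T,T)`; `α = (2,1), (1,1)` and the `n = 1` points `(1,1), (√2,1)` exact).
-/

namespace Summit.Schanuel.Schanuel.Theorems

open MvPolynomial Filter
open Literature.NumberTheory.Transcendental

/-- `D (X₁^b) = b · X₁^b`. [folklore] -/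
private theorem PolarPhantoms.royD_X_one_pow (b : ℕ) :
    royD (X 1 ^ b) = (b : MvPolynomial (Fin 2) ℤ) * X 1 ^ b := by
  induction b with
  | zero => simp [royD]
  | succ b ih =>
    rw [pow_succ, royD_mul, ih, royD_X_one]
    push_cast
    ring

/-- `X₁^b ∣ D^k (X₀^a X₁^b)`. [folklore] -/
private theorem PolarPhantoms.iterate_royD_monomial (k a b : ℕ) :
    ∃ Q : MvPolynomial (Fin 2) ℤ, royD^[k] (X 0 ^ a * X 1 ^ b) = Q * X 1 ^ b := by
  induction k with
  | zero => exact ⟨X 0 ^ a, rfl⟩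
  | succ k ih =>
    obtain ⟨Q, hQ⟩ := ih
    refine ⟨royD Q + Q * (b : MvPolynomial (Fin 2) ℤ), ?_⟩
    rw [Function.iterate_succ_apply', hQ, royD_mul, PolarPhantoms.royD_X_one_pow]
    ring

/-- Ring homomorphisms commute with the evaluation of integer polynomials. [folklore] -/
private theorem PolarPhantoms.aeval_through {S T : Type*} [CommRing S] [CommRing T]
    (φ : S →+* T) (g : Fin 2 → S) (P : MvPolynomial (Fin 2) ℤ) :
    φ (MvPolynomial.aeval (R := ℤ) g P) = MvPolynomial.aeval (R := ℤ) (fun i => φ (g i)) P := by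
  have h : φ.comp (MvPolynomial.aeval (R := ℤ) g).toRingHom =
      (MvPolynomial.aeval (R := ℤ) fun i => φ (g i)).toRingHom := by
    refine MvPolynomial.ringHom_ext (fun r => ?_) (fun i => ?_)
    · simp
    · simp
  simpa using RingHom.congr_fun h P

/-- For transcendental `ξ`, "constant term of the `ξ`-expansion" is a well-defined `ℚ`-linear
functional on `ℚ[ξ] ⊂ ℂ`; extend it to `ℂ`. [folklore] -/
private theorem PolarPhantoms.exists_constTerm {ξ : ℂ} (hξ : Transcendental ℚ ξ) :
    ∃ L : ℂ →ₗ[ℚ] ℚ, ∀ p : Polynomial ℚ, L (Polynomial.aeval ξ p) = Polynomial.aeval (0:ℚ) p := by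
  have hι : Function.Injective ((Polynomial.aeval ξ).toLinearMap : Polynomial ℚ →ₗ[ℚ] ℂ) :=
    transcendental_iff_injective.mp hξ
  obtain ⟨L, hL⟩ := LinearMap.exists_extend
    ((Polynomial.aeval (0:ℚ)).toLinearMap ∘ₗ
      (LinearEquiv.ofInjective _ hι).symm.toLinearMap)
  refine ⟨L, fun p => ?_⟩
  have h := LinearMap.congr_fun hL (LinearEquiv.ofInjective _ hι p)
  simp only [LinearMap.coe_comp, Function.comp_apply, Submodule.subtype_apply,
    LinearEquiv.coe_toLinearMap, LinearEquiv.symm_apply_apply, AlgHom.toLinearMap_apply,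
    LinearEquiv.ofInjective_apply] at h
  exact h

/-- Roy's window `1 < s₀ < u < (1 + t₀ + t₁)/2` gives `s₀ < t₀ + t₁`, hence eventually more box
monomials with `b ≥ 1` than derivatives: `⌊N^{s₀}⌋ + 1 < (⌊N^{t₀}⌋ + 1) ⌊N^{t₁}⌋`. [folklore] -/
private theorem PolarPhantoms.eventually_dim {s₀ t₀ t₁ : ℝ} (ht₀ : 0 < t₀) (ht₁ : 0 < t₁)
    (hst : s₀ < t₀ + t₁) :
    ∀ᶠ N : ℕ in atTop, ⌊(N : ℝ) ^ s₀⌋₊ + 1 < (⌊(N : ℝ) ^ t₀⌋₊ + 1) * ⌊(N : ℝ) ^ t₁⌋₊ := by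
  have hδ : 0 < t₀ + t₁ - max s₀ t₀ := by
    rcases le_total s₀ t₀ with h | h
    · rw [max_eq_right h]; linarith
    · rw [max_eq_left h]; linarith
  have h4 : ∀ᶠ N : ℕ in atTop, (4 : ℝ) ≤ (N : ℝ) ^ (t₀ + t₁ - max s₀ t₀) :=
    ((tendsto_rpow_atTop hδ).comp tendsto_natCast_atTop_atTop).eventually_ge_atTop 4
  filter_upwards [h4, eventually_ge_atTop 1] with N h4N h1N
  have h4N : (4 : ℝ) ≤ (N : ℝ) ^ (t₀ + t₁ - max s₀ t₀) := h4N
  have hN1 : (1 : ℝ) ≤ N := by exact_mod_cast h1N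
  have hN0 : (0 : ℝ) < N := by linarith
  have he0 : 0 ≤ max s₀ t₀ := le_trans ht₀.le (le_max_right _ _)
  have hEs : (N : ℝ) ^ s₀ ≤ (N : ℝ) ^ max s₀ t₀ :=
    Real.rpow_le_rpow_of_exponent_le hN1 (le_max_left _ _)
  have hEt : (N : ℝ) ^ t₀ ≤ (N : ℝ) ^ max s₀ t₀ :=
    Real.rpow_le_rpow_of_exponent_le hN1 (le_max_right _ _)
  have hE1 : (1 : ℝ) ≤ (N : ℝ) ^ max s₀ t₀ := Real.one_le_rpow hN1 he0
  have hsplit : (N : ℝ) ^ (t₀ + t₁) = (N : ℝ) ^ max s₀ t₀ * (N : ℝ) ^ (t₀ + t₁ - max s₀ t₀) := by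
    rw [← Real.rpow_add hN0]; ring_nf
  have hprod : (N : ℝ) ^ (t₀ + t₁) = (N : ℝ) ^ t₀ * (N : ℝ) ^ t₁ := Real.rpow_add hN0 _ _
  have hbig : 4 * (N : ℝ) ^ max s₀ t₀ ≤ (N : ℝ) ^ (t₀ + t₁) := by
    rw [hsplit]
    have := mul_le_mul_of_nonneg_left h4N (le_trans zero_le_one hE1)
    linarith
  have hK : (⌊(N : ℝ) ^ s₀⌋₊ : ℝ) ≤ (N : ℝ) ^ s₀ := Nat.floor_le (Real.rpow_nonneg hN0.le _)
  have hD0 : (N : ℝ) ^ t₀ < (⌊(N : ℝ) ^ t₀⌋₊ : ℝ) + 1 := Nat.lt_floor_add_one _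
  have hD1 : (N : ℝ) ^ t₁ - 1 < (⌊(N : ℝ) ^ t₁⌋₊ : ℝ) := Nat.sub_one_lt_floor _
  have ht0pos : 0 < (N : ℝ) ^ t₀ := Real.rpow_pos_of_pos hN0 _
  have hD1nn : (0 : ℝ) ≤ (⌊(N : ℝ) ^ t₁⌋₊ : ℝ) := Nat.cast_nonneg _
  have h1 : (N : ℝ) ^ t₀ * ((N : ℝ) ^ t₁ - 1) < (N : ℝ) ^ t₀ * (⌊(N : ℝ) ^ t₁⌋₊ : ℝ) :=
    mul_lt_mul_of_pos_left hD1 ht0pos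
  have h2 : (N : ℝ) ^ t₀ * (⌊(N : ℝ) ^ t₁⌋₊ : ℝ) ≤
      ((⌊(N : ℝ) ^ t₀⌋₊ : ℝ) + 1) * (⌊(N : ℝ) ^ t₁⌋₊ : ℝ) :=
    mul_le_mul_of_nonneg_right hD0.le hD1nn
  have hreal : (⌊(N : ℝ) ^ s₀⌋₊ : ℝ) + 1 < ((⌊(N : ℝ) ^ t₀⌋₊ : ℝ) + 1) * (⌊(N : ℝ) ^ t₁⌋₊ : ℝ) := by
    nlinarith
  exact_mod_cast hreal

/-- The specialization phantom at `y = (1, ξ)`, `α = (ξ, 1)`: for transcendental `ξ` and any `N` with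
`⌊N^{s₀}⌋ + 1 < (⌊N^{t₀}⌋ + 1)⌊N^{t₁}⌋` there is a family `θ` killing every box value (for all
`k ≤ N^{s₀}` and ALL `m`) with `θ_{ab}(1) ≠ 0` for some `(a, b)` in the box. [folklore] -/
private theorem PolarPhantoms.specialization_phantom {ξ : ℂ} (hξ : Transcendental ℚ ξ)
    {s₀ s₁ t₀ t₁ : ℝ} {N : ℕ}
    (hdim : ⌊(N : ℝ) ^ s₀⌋₊ + 1 < (⌊(N : ℝ) ^ t₀⌋₊ + 1) * ⌊(N : ℝ) ^ t₁⌋₊) :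
    ∃ θ : ℕ → ℕ → (ℂ →ₗ[ℚ] ℚ),
      (∀ (k : ℕ) (m : Fin 2 → ℕ), (k : ℝ) ≤ (N : ℝ) ^ s₀ → (∀ j, (m j : ℝ) ≤ (N : ℝ) ^ s₁) →
        (∑ a ∈ Finset.range (⌊(N : ℝ) ^ t₀⌋₊ + 1), ∑ b ∈ Finset.range (⌊(N : ℝ) ^ t₁⌋₊ + 1),
          θ a b (MvPolynomial.aeval ![∑ j, ((m j : ℕ) : ℂ) * ![(1 : ℂ), ξ] j,
            ∏ j, ![ξ, (1 : ℂ)] j ^ (m j)] (royD^[k] (X 0 ^ a * X 1 ^ b)))) = 0) ∧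
      ∃ a b : ℕ, (a : ℝ) ≤ (N : ℝ) ^ t₀ ∧ (b : ℝ) ≤ (N : ℝ) ^ t₁ ∧ θ a b 1 ≠ 0 := by
  classical
  set D0 := ⌊(N : ℝ) ^ t₀⌋₊ with hD0
  set D1 := ⌊(N : ℝ) ^ t₁⌋₊ with hD1
  set K := ⌊(N : ℝ) ^ s₀⌋₊ with hK
  obtain ⟨L, hL⟩ := PolarPhantoms.exists_constTerm hξ
  have hL1 : L 1 = 1 := by simpa using hL 1
  -- the specialization `ξ ↦ 0` on box values
  have key : ∀ (m : Fin 2 → ℕ) (P : MvPolynomial (Fin 2) ℤ),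
      L (MvPolynomial.aeval ![∑ j, ((m j : ℕ) : ℂ) * ![(1 : ℂ), ξ] j,
            ∏ j, ![ξ, (1 : ℂ)] j ^ (m j)] P)
        = MvPolynomial.aeval ![((m 0 : ℕ) : ℚ), (0 : ℚ) ^ (m 0)] P := by
    intro m P
    set g : Fin 2 → Polynomial ℚ :=
      ![Polynomial.C ((m 0 : ℕ) : ℚ) + Polynomial.C ((m 1 : ℕ) : ℚ) * Polynomial.X,
        Polynomial.X ^ (m 0)] with hg
    have hpt : (![∑ j, ((m j : ℕ) : ℂ) * ![(1 : ℂ), ξ] j, ∏ j, ![ξ, (1 : ℂ)] j ^ (m j)] :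
        Fin 2 → ℂ) = fun i => (Polynomial.aeval ξ).toRingHom (g i) := by
      funext i
      fin_cases i <;> simp [hg, Fin.sum_univ_two, Fin.prod_univ_two]
    have hrat : (![((m 0 : ℕ) : ℚ), (0 : ℚ) ^ (m 0)] : Fin 2 → ℚ) =
        fun i => (Polynomial.aeval (0 : ℚ)).toRingHom (g i) := by
      funext i
      fin_cases i <;> simp [hg]
    rw [hpt, ← PolarPhantoms.aeval_through, hrat, ← PolarPhantoms.aeval_through]
    exact hL _
  -- the linear system at the collapsed point (0, 1)
  let A : Matrix (Fin (K + 1)) (Fin (D0 + 1) × Fin D1) ℚ := fun k p =>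
    MvPolynomial.aeval ![(0 : ℚ), 1] (royD^[(k : ℕ)] (X 0 ^ (p.1 : ℕ) * X 1 ^ ((p.2 : ℕ) + 1)))
  have hker : LinearMap.ker (Matrix.mulVecLin A) ≠ ⊥ := by
    apply LinearMap.ker_ne_bot_of_finrank_lt
    simp only [Module.finrank_fintype_fun_eq_card, Fintype.card_fin, Fintype.card_prod]
    exact hdim
  obtain ⟨z, hz, hz0⟩ := Submodule.exists_mem_ne_zero_of_ne_bot hker
  rw [LinearMap.mem_ker, Matrix.mulVecLin_apply] at hz
  obtain ⟨p₀, hp₀⟩ : ∃ p, z p ≠ 0 := Function.ne_iff.mp hz0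
  -- extend `z` by zero to all of ℕ × ℕ (shifting `b` by one)
  let zext : ℕ → ℕ → ℚ := fun a b =>
    if h : a < D0 + 1 ∧ 0 < b ∧ b - 1 < D1 then z (⟨a, h.1⟩, ⟨b - 1, h.2.2⟩) else 0
  have hzext_succ : ∀ (a : Fin (D0 + 1)) (j : Fin D1), zext a ((j : ℕ) + 1) = z (a, j) := by
    intro a j
    simp only [zext]
    rw [dif_pos ⟨a.2, Nat.succ_pos _, by rw [Nat.add_sub_cancel]; exact j.2⟩]
    congr 1
  have hzext_zero : ∀ a, zext a 0 = 0 := by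
    intro a
    simp [zext]
  set θ : ℕ → ℕ → (ℂ →ₗ[ℚ] ℚ) := fun a b => zext a b • L with hθ
  refine ⟨θ, ?_, p₀.1, (p₀.2 : ℕ) + 1, ?_, ?_, ?_⟩
  · intro k m hk _hm
    have hkK : k < K + 1 := Nat.lt_succ_of_le (Nat.le_floor hk)
    have hsummand : ∀ a b,
        θ a b (MvPolynomial.aeval ![∑ j, ((m j : ℕ) : ℂ) * ![(1 : ℂ), ξ] j,
            ∏ j, ![ξ, (1 : ℂ)] j ^ (m j)] (royD^[k] (X 0 ^ a * X 1 ^ b)))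
          = zext a b * MvPolynomial.aeval ![((m 0 : ℕ) : ℚ), (0 : ℚ) ^ (m 0)]
              (royD^[k] (X 0 ^ a * X 1 ^ b)) := by
      intro a b
      simp only [hθ, LinearMap.smul_apply, smul_eq_mul, key]
    simp_rw [hsummand]
    by_cases hm0 : m 0 = 0
    · -- collapsed point (0, 1): the kernel equation for row `k`
      have hpt0 : (![((m 0 : ℕ) : ℚ), (0 : ℚ) ^ (m 0)] : Fin 2 → ℚ) = ![0, 1] := by
        simp [hm0]
      rw [hpt0]
      have hzk := congr_fun hz ⟨k, hkK⟩
      simp only [Matrix.mulVec, dotProduct, Pi.zero_apply] at hzk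
      rw [Fintype.sum_prod_type] at hzk
      calc ∑ a ∈ Finset.range (D0 + 1), ∑ b ∈ Finset.range (D1 + 1),
              zext a b * MvPolynomial.aeval ![(0 : ℚ), 1] (royD^[k] (X 0 ^ a * X 1 ^ b))
          = ∑ a ∈ Finset.range (D0 + 1), ∑ j ∈ Finset.range D1,
              zext a (j + 1) * MvPolynomial.aeval ![(0 : ℚ), 1]
                (royD^[k] (X 0 ^ a * X 1 ^ (j + 1))) := by
            refine Finset.sum_congr rfl fun a _ => ?_
            rw [Finset.sum_range_succ', hzext_zero, zero_mul, add_zero]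
        _ = ∑ a : Fin (D0 + 1), ∑ j : Fin D1,
              zext a ((j : ℕ) + 1) * MvPolynomial.aeval ![(0 : ℚ), 1]
                (royD^[k] (X 0 ^ (a : ℕ) * X 1 ^ ((j : ℕ) + 1))) := by
            rw [← Fin.sum_univ_eq_sum_range]
            refine Finset.sum_congr rfl fun a _ => ?_
            rw [← Fin.sum_univ_eq_sum_range]
        _ = ∑ a : Fin (D0 + 1), ∑ j : Fin D1, A ⟨k, hkK⟩ (a, j) * z (a, j) := by
            refine Finset.sum_congr rfl fun a _ => Finset.sum_congr rfl fun j _ => ?_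
            rw [hzext_succ, mul_comm]
        _ = 0 := hzk
    · -- points (m₀, 0), m₀ ≥ 1: every value with b ≥ 1 vanishes, and zext a 0 = 0
      refine Finset.sum_eq_zero fun a _ => Finset.sum_eq_zero fun b _ => ?_
      rcases Nat.eq_zero_or_pos b with hb | hb
      · rw [hb, hzext_zero, zero_mul]
      · obtain ⟨Q, hQ⟩ := PolarPhantoms.iterate_royD_monomial k a b
        rw [hQ, map_mul, map_pow]
        have hX1 : MvPolynomial.aeval ![((m 0 : ℕ) : ℚ), (0 : ℚ) ^ (m 0)]
            (X 1 : MvPolynomial (Fin 2) ℤ) = 0 := by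
          simp [zero_pow hm0]
        rw [hX1, zero_pow hb.ne', mul_zero, mul_zero]
  · have h : (p₀.1 : ℕ) ≤ D0 := Nat.lt_succ_iff.mp p₀.1.2
    exact (Nat.le_floor_iff (Real.rpow_nonneg (Nat.cast_nonneg N) t₀)).mp h
  · have h : (p₀.2 : ℕ) + 1 ≤ D1 := p₀.2.2
    exact_mod_cast (Nat.le_floor_iff (Real.rpow_nonneg (Nat.cast_nonneg N) t₁)).mp h
  · simp only [hθ, LinearMap.smul_apply, smul_eq_mul, hL1, mul_one]
    rw [hzext_succ]
    exact hp₀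

/-- Refutes `PolarPhantoms.PhantomsAreTraceless` [refuted-substantive]: at the point `n = 2`,
`y = (1, e)`, `α = (e, 1)` (`ℚ`-free `y`, `α ∈ (ℂˣ)²`, `trdeg_ℚ ℚ(y, α) = 1 < 2`) the specialization
`e ↦ 0` of `ℚ[e]` collapses Roy's multi-orbit `(m₀ + m₁ e, e^{m₀})` onto `{(0,1)} ∪ ℕ_{≥1} × {0}`, so
`θ_{ab} = z_{ab} · (`constant term in `e)` with `z` in the kernel of the `(⌊N^{s₀}⌋+1) ×
(⌊N^{t₀}⌋+1)⌊N^{t₁}⌋` system at `(0,1)` is a phantom with `θ_{ab}(1) = z_{ab} ≠ 0`; Roy's window gives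
`s₀ < t₀ + t₁`, so this happens for every admissible parameter set and all large `N`.
Witness pattern: `y = (1, ξ)`, `α ⊂ ξ·ℚ[ξ]` (also `α = (ξ, ξ)`, `(ξ, 2ξ)`: torsion-free, multiplicatively
independent). No cheap repair: excluding roots of unity / dependent `α` is still killed by `α = (ξ, 2ξ)`;
"all `α_j` algebraic" misses the witness but makes the crux unusable at `α = exp ∘ y` in `closes`;
"only `α = exp ∘ y`" misses it but is Schanuel-equivalent given `PolarGlue` (no longer exp-free or
testable at non-exponential points — the route's thesis). The same witness kills the P-wise pivot and
(with Siegel's lemma for the height) the target `PolarSchanuel`. barrier-candidate: specialization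
phantoms — Roy-box exactness fails at any point whose coordinate ring admits a place collapsing the
multi-orbit to finitely many points, because `s₀ < t₀ + t₁` in window (1). [folklore] -/
theorem PolarPhantomsPhantomsAreTraceless_refuted :
    ¬ Summit.Schanuel.Schanuel.Theses.PolarPhantoms.PhantomsAreTraceless := by
  intro hC
  set ξ : ℂ := Complex.exp 1 with hξ_def
  have hξ : Transcendental ℚ ξ := transcendental_rat_cexp_one
  have hξ0 : ξ ≠ 0 := Complex.exp_ne_zero 1
  have hy : LinearIndependent ℚ ![(1 : ℂ), ξ] :=
    (Literature.Barriers.Schanuel.linearIndependent_pair_of_transcendental hξ).2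
  have hα : ∀ j : Fin 2, ![ξ, (1 : ℂ)] j ≠ 0 := by
    intro j
    fin_cases j <;> simp [hξ0]
  have htr : Algebra.trdeg ℚ ↥(IntermediateField.adjoin ℚ
      (Set.range ![(1 : ℂ), ξ] ∪ Set.range ![ξ, (1 : ℂ)])) < ((2 : ℕ) : Cardinal) := by
    have hset : Set.range ![(1 : ℂ), ξ] ∪ Set.range ![ξ, (1 : ℂ)] = ({ξ} : Set ℂ) ∪ {1} := by
      ext w
      simp only [Matrix.range_cons, Matrix.range_empty, Set.union_empty, Set.mem_union,
        Set.mem_singleton_iff]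
      tauto
    rw [hset]
    -- `trdeg ℚ(ξ, 1) = trdeg ℚ(ξ) ≤ 1 < 2` (instances on `↥ℚ⟮…⟯` agree up to unfolding, so `refine`)
    refine lt_of_le_of_lt ((Literature.Barriers.Schanuel.trdeg_adjoin_union_eq_of_isAlgebraic
      (K := ℚ) ({ξ} : Set ℂ) ({1} : Set ℂ) (fun x hx => by
        rw [Set.mem_singleton_iff.mp hx]; exact isAlgebraic_one)).trans_le
      (Literature.Barriers.Schanuel.trdeg_adjoin_singleton_le_one (K := ℚ) ξ)) ?_
    norm_num
  obtain ⟨s₀, s₁, t₀, t₁, u, hadm, hev⟩ := hC 2 ![1, ξ] ![ξ, 1] hy hα htr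
  obtain ⟨_, _, ht₀, ht₁, _, hwin, hlo, hhi⟩ := hadm
  have h1s₀ : 1 < s₀ := lt_of_le_of_lt (le_max_left _ _) (lt_of_lt_of_le hwin (min_le_left _ _))
  have hs₀u : s₀ < u := lt_of_le_of_lt (le_max_left _ _) hlo
  have hst : s₀ < t₀ + t₁ := by linarith
  obtain ⟨N, hN, hdimN⟩ := (hev.and (PolarPhantoms.eventually_dim ht₀ ht₁ hst)).exists
  obtain ⟨θ, hph, a, b, ha, hb, hne⟩ := PolarPhantoms.specialization_phantom (s₁ := s₁) hξ hdimN
  exact hne (hN θ hph a b ha hb)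

end Summit.Schanuel.Schanuel.Theorems
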